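import Summits.RiemannHypothesis.RiemannHypothesis.Theorems.PfPersistenceM2LeakAssembly
import Literature.NumberTheory.LFunctions.RiemannXiHadamardProduct
import Summits.RiemannHypothesis.RiemannHypothesis.Theorems.WeilGroundStateGroundStatesConvergeToXiStubMomentsOfStrip
import HarnessLib

/-!
# M2 upper half (7/7): the norm floor, the HEADLINE — the upper law reduced to ONE prolate leak bound — and its sup form

pub-rhpf cell (M2 seat, generation 3) — part 7 of 7 of the M2 UPPER-HALF packet (parts 1–6:
`PfPersistenceM2UpperLawCount`, `…ProlateWitness`, `…Mollified`, `…WindowSum`, `…LeakCriteria`,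
`…LeakAssembly`).  HONEST FRAMING: long-odds MECHANISM SEARCH; no RH claims.
Everything in the packet is either PROVED (kernel-checked, RH-free) or an explicitly named `def … : Prop`
taken as an argument; nothing in between.  Nothing here implies or assumes RH.

The M2 route (`PfPersistenceM2Thermometer.lean`, `PfPersistenceM2ThreeLaws.lean`) needs the UPPER law for the
ground energy `ε(a) = weilGroundEnergy a` with an EXPLICIT polynomial exponent,
`ε(a) ≤ C μ^{B_U} e^{-4πμ}` (`μ = e^{2a}`), to be compared with the gap exponent `B_G`
(`m2_asymptotic_of_three_laws` needs `B_U < B_G`).  The tree's `ConnesLawUpper` hides the exponent behind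
`∃ B`.  HEADLINE (§L of this file, PROVED):

  `connesLawUpperWith_of_prolateLeak :
     existsUnique_isProlateFunction → prolateGuess_tendsto_riemannXi →
     0 ≤ A → 0 ≤ p → ProlateLeakL1 A p Λ → 0 < δ → δ ≤ 1 → ConnesLawUpperWith (2 * p + 1 + δ)`

i.e. the upper half of Connes's law WITH EXPONENT `2p + 1 + δ` follows from ONE RH-free statement about
prolate spheroidal functions — the `L¹` leak bound (H-LEAK-L1) with exponent `p` — plus two NAMED LITERATURE
FACTS already in the tree (Slepian–Pollak uniqueness of the prolate functions; Connes–Consani–Moscovici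
Lemma 7.3 = Fact 6.4 of the Letter), and hence (`connesLawUpper_of_prolateLeak`) the tree's `ConnesLawUpper`.
The same proof gives the WITNESS (Rayleigh-quotient) form `connesLawUpperWitnessWith_of_prolateLeak :
… → ConnesLawUpperWitnessWith (2p + 1 + δ)` — eventually in `a` a normalised window test (the mollified
prolate guess) with Weil energy `≤ C μ^{2p+1+δ} e^{-4πμ}` — which is literally the pair of hypotheses
`hp`, `hU` of `PfPersistenceM2Laws.m2_asymptotic_of_three_laws` with `B_U = 2p + 1 + δ`.  And the input may be
taken in the `sup` form `ProlateLeakSup A p Λ` — `|𝓔(h_λ)(u)| ≤ A N^p e^{-2πN} √u` for `0 < u < λ⁻¹`, i.e.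
`sup_{u<1/λ}|S_λ(u)| ≤ A λ^{2p} e^{-2πλ²}`, LITERALLY the shape of the bundle's THEOREM E′ — via the PROVED
`prolateLeakL1_of_sup : ProlateLeakSup A p Λ → ProlateLeakL1 A p (max Λ 1)` (§M):
`connesLawUpperWitnessWith_of_prolateLeakSup`, `connesLawUpperWith_of_prolateLeakSup`.

## Ledger

PROVED in the packet (kernel-checked, RH-free; §K–§L in this file, §A–§J in parts 1–6):
* §A `ConnesLawUpperWith B` (the exponent-explicit upper law) `→ ConnesLawUpper`; its WITNESS form
  `ConnesLawUpperWitnessWith B` (normalised window tests, `→ ConnesLawUpperWith B`,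
  `connesLawUpperWith_of_witnessWith`, normalisation `connesLawUpperWitnessWith_of_rayleigh`);
  exponent-keeping copies of the tree's reductions (`connesLawUpperWith_of_explicit`, `…_of_zeroSums`).
* §B SHARP COUNTING `exists_windowCount`: for every weight `w : ℕ → ℝ≥0` and finite set `F` of non-trivial
  zeros, `Σ_{ρ∈F} m(ρ) w(j(ρ)) ≤ C Σ_{j<N} log(j+2) w(j)`, `j(ρ) = |round γ|` (`windowIndex`), ONE absolute `C`
  (Jensen window count `exists_sum_zetaZeroWindow_le` + reflection `ρ ↦ 1 − ρ̄`); `connesLawUpperWith_of_windowBound`,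
  `exists_weilGroundEnergy_le_of_windowBound`.  (The tree's `connesLawUpper_of_pointwise` charges every zero
  `(1+γ²)^{-2}`: for a mollifier of radius `η` that costs `η^{-4}` = FOUR powers of `μ`; the window count costs
  `η^{-1-ε}` = ONE power.  This is the difference between `B_U = 2p + 4 + δ` and `B_U = 2p + 1 + δ`.)
* §C THE ZEROS' ABSCISSAE `exists_div_log_le_re`: `∃ c₀ > 0`, `c₀/log(|γ|+4) ≤ Re ρ ≤ 1 − c₀/log(|γ|+4)` at every
  non-trivial zero (tree: de la Vallée-Poussin region `classicalZFRData_riemannZeta.zeroFree` + reflection).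
  It converts the factor `1/Re ρ` of the prolate tail into a harmless `log(|γ|+4)`.
* §D–§E THE RAW PROLATE WITNESS at the zeros: for Connes's guess transported to the additive variable,
  `k₀(t) = 𝓔(h_λ)(e^t)·1_{|t| ≤ log λ}`: `weilMellin k₀ s = M_λ(s − ½)` (`prolateGuessMellin`, `u = e^t`) and, by
  the truncation identity `prolateGuessMellin_eq` (the main term `ζ(s+½)·𝓜h_λ` DIES AT EVERY ZERO, on the line
  or not), `‖k̂₀(ρ)‖ ≤ ∫_{(0,λ⁻¹]} |𝓔(h_λ)(u)| u^{Re ρ − 3/2} du`; evenness/measurability/positivity facts for the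
  prolate interface (`isProlateFunction_even`, …).
* §F with (H-LEAK-L1): `‖k̂₀(ρ)‖ ≤ A N^p e^{-2πN}/Re ρ ≤ (A/c₀) N^p e^{-2πN} log(|γ|+4)` (`λ² = N`).
* §G MOLLIFICATION ALGEBRA for the discontinuous `k₀`: `k = k₀ ⋆ φ_n` is a Weil test function supported in
  `[−log λ − 1/(n+1), log λ + 1/(n+1)]` with `k̂(s) = M_λ(s−½)·φ̂_n(s)` (`isWeilTest_weilConv_moll'`,
  `weilMellin_weilConv_of_integrable`, `leakWitness`, `weilMellin_leakWitness`).
* §H the elementary window sum `Σ_j log(j+2) log²(j+5) min(1, K/(j+1))² ≤ C_ε K^{1+ε}` (`windowSum_le`) and the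
  small-window fallback (the tree's `weilGroundEnergy_le_const`), `connesLawUpperWith_of_eventually`.
* §I THE ASSEMBLY `exists_rayleigh_witness_of_leak` / `connesLawUpperWith_of_leak` /
  `connesLawUpperWitnessWith_of_leak` (all hypotheses explicit), §J the MOLLIFIER DECAY
  `mollifierMellinDecay : ‖φ̂_n(s)‖‖s−½‖ ≤ C(n+1)e^{|Re s−½|/(n+1)}` (scaling `φ_n(x) = (n+1)φ_0((n+1)x)` + one
  integration by parts), §K the NORM FLOOR `leakWitnessNormFloor_of_tendsto : c ≤ (log N + 2)‖k‖₂²` from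
  `k̂(½) = M_λ(0)`, Fact 6.4 at `s = 0`, `ξ(½) ≠ 0` (`riemannXi_one_half_ne_zero`) and Cauchy–Schwarz,
  §L the headline, §M the `sup` form `ProlateLeakSup` ⇒ (H-LEAK-L1) (`prolateLeakL1_of_sup`: `β∫₀^{λ⁻¹} u^{β−1} du
  = λ^{−β} ≤ 1`) and the headline from it.  Witness at window `a`: `n+1 = ⌈μ⌉₊+1`, `N = ⌊μ e^{-2/(n+1)}⌋₊ ≥ μ − 3`,
  `λ = √N`.

HYPOTHESIS (the one input, typed in part 2, RH-free; NOT proved in the packet):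
* §F `ProlateLeakL1 A p Λ` (H-LEAK-L1): for integer `N = λ² ≥ Λ`, every prolate pair and `0 < β ≤ 1`,
  `β ∫_{(0,λ⁻¹]} |𝓔(h_λ)(u)| u^{β−3/2} du ≤ A N^p e^{-2πN}`.  A statement about prolate spheroidal wave
  functions and Riemann sums only.  STATUS: PROVED ON PAPER, NOT FORMALISED, with `p = 9/2`: the connes-x13
  bundle (`papers/RiemannHypothesis/connes-x13/paper/PROOF-ATTEMPT.md` §3.6 THEOREM E′ + P1STAR-PROOF Cor. 11,
  "PROVED mod I1–I3" = three cited classical inputs: the finite-Fourier eigenrelation of `ψ_k`, Osipov's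
  `χ_k(c) < c²`, Poisson summation) gives `sup_{0<u<1/λ} |Σ_{n≥1} h_λ(nu)| ≤ Σ*_λ` with
  `Σ*_λ ≍ 10⁴ λ⁹ e^{-2πλ²}` and `Σ*_λ ≤ 10⁻¹⁹` for `λ² ≥ 13`; since `𝓔(h_λ)(u) = √u Σ_{n≥1} h_λ(nu)` this is
  `ProlateLeakSup Σ-const (9/2) 13`-shaped, hence (§M, `prolateLeakL1_of_sup`) (H-LEAK-L1) with `p = 9/2`.  The
  `L¹` form is the weaker statement the assembly actually consumes (it is what `‖k̂₀(ρ)‖` integrates); the `sup`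
  form `ProlateLeakSup` (§M) is the bundle's.  `S_λ(u) = Σ_{n≥1} h_λ(nu)` is a FINITE sum, bounded, with no
  blow-up at `λu → 1` (bundle §3.2 (iii)).  The bundle records (DATA, `numerics/fact64/RATE.md` part (d′)) that
  `Σ*_λ` is `498, 899, 2994` times the true `sup|S_λ|` at `λ² = 8, 13, 20` (true size `≈ 0.2·|ψ_4(1)| ≍ N^{11/4}
  e^{-2πN}` by Slepian's asymptotics, i.e. `p_true = 11/4`).

NAMED LITERATURE FACTS used as hypotheses (tree, `def … : Prop`, proved in print):
`existsUnique_isProlateFunction` (Slepian–Pollak / Sturm–Liouville), `prolateGuess_tendsto_riemannXi`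
(CCM25 Lemma 7.3; `[cite: ConnesConsaniMoscovici2025, Lemma 7.3]`).

## What this says for M2 (context; NO proof depends on it)

With `PfPersistenceM2ThreeLaws.m2_asymptotic_of_three_laws` the M2 conclusion needs `B_U < B_G`.  Here
`B_U = 2p + 1 + δ`, so M2's upper half needs a leak exponent `p < (B_G − 1)/2`.  DATA (pub-rhpf
`M2-DATA.md` D1/D7/D9, atlas v1.6.5; gap exponent read off `ε₂/ε₁`): `B_G ∈ [8.7, 9.3]` (global fit 9.30,
windowed fits `μ ≥ 13–20` drifting to 8.8–8.9, toward the prolate prediction 9), i.e. `p < 3.9` would be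
needed; the paper-proved `p = 9/2` misses by `0.35–0.65` and is loose by `≥ 10²·⁷` in the constant at
`λ² ≤ 20` (DATA above; `p_true = 11/4`), so the SHARP leak exponent — not its existence — is what M2's upper
half now turns on.  The crude count (`connesLawUpper_of_pointwise`) would need `p < 2.4`.  No lower bound on `ε₁` is proved or
claimed anywhere: that input is RH-strength (`PfPersistenceM2Laws.m2_inputs_floor_is_RH`).

References: A. Connes, letter (2026) §6 (6.1)–(6.6); Connes–Consani–Moscovici (2025/2026) §7, Lemma 7.3
[ConnesConsaniMoscovici2025]; the tree files cited by name above (their `[cite: …]` tags carry the classical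
sources: de la Vallée-Poussin's region, Jensen's window count, the explicit formula); connes-x13 bundle
(`papers/RiemannHypothesis/connes-x13`), THEOREM E′ (paper proof, refereed inside the bundle, not formalised).
-/

noncomputable section

set_option linter.dupNamespace false  -- the mandated namespace repeats `RiemannHypothesis`

open Complex Filter Set Topology Metric MeasureTheory
open Literature.NumberTheory.LFunctions
open scoped ComplexConjugate Convolution

namespace Summit.RiemannHypothesis.RiemannHypothesis.Theorems.PfPersistenceM2Leak

/-! ## §K The norm floor (proved): Cauchy–Schwarz + Fact 6.4 + `ξ(½) ≠ 0` -/

section Floor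

open WeilContinuous

/-- Cauchy–Schwarz without `L²`: `‖∫ k‖² ≤ (b − a) · ∫ ‖k‖²` for a test function supported in `[a, b]`. -/
theorem norm_integral_sq_le {k : ℝ → ℂ} (hk : IsWeilTest k) {a b : ℝ} (hab : a < b)
    (hs : tsupport k ⊆ Icc a b) :
    ‖∫ t : ℝ, k t‖ ^ 2 ≤ (b - a) * ∫ t : ℝ, ‖k t‖ ^ 2 := by
  have hkc : Continuous k := hk.1.continuous
  have hki : Integrable k := hkc.integrable_of_hasCompactSupport hk.2
  have hni : Integrable fun t ↦ ‖k t‖ := hki.norm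
  have hcont : Continuous fun t : ℝ ↦ ‖k t‖ ^ 2 := hkc.norm.pow 2
  have hcs : HasCompactSupport fun t : ℝ ↦ ‖k t‖ ^ 2 :=
    hk.2.comp_left (g := fun z : ℂ ↦ ‖z‖ ^ 2) (by simp)
  have hsqi : Integrable fun t : ℝ ↦ ‖k t‖ ^ 2 := hcont.integrable_of_hasCompactSupport hcs
  obtain ⟨I, hI⟩ : ∃ I : ℝ, I = ∫ t : ℝ, ‖k t‖ ^ 2 := ⟨_, rfl⟩
  obtain ⟨m, hmd⟩ : ∃ m : ℝ, m = ‖∫ t : ℝ, k t‖ := ⟨_, rfl⟩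
  have hI0 : 0 ≤ I := by rw [hI]; exact integral_nonneg fun _ ↦ by positivity
  have hm : m ≤ ∫ t : ℝ, ‖k t‖ := by rw [hmd]; exact norm_integral_le_integral_norm _
  have hm0' : 0 ≤ m := by rw [hmd]; exact norm_nonneg _
  rw [← hI, ← hmd]
  by_cases hm0 : m = 0
  · rw [hm0]; nlinarith
  have hmpos : 0 < m := lt_of_le_of_ne hm0' (Ne.symm hm0)
  obtain ⟨θ, hθ⟩ : ∃ θ : ℝ, θ = (b - a) / m := ⟨_, rfl⟩
  have hθ0 : 0 < θ := by rw [hθ]; exact div_pos (by linarith) hmpos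
  have hpt : ∀ t : ℝ, ‖k t‖ ≤
      θ / 2 * ‖k t‖ ^ 2 + 1 / (2 * θ) * (Icc a b).indicator (fun _ ↦ (1 : ℝ)) t := by
    intro t
    by_cases ht : t ∈ Icc a b
    · rw [indicator_of_mem ht, mul_one]
      have h1 : 0 ≤ (θ * ‖k t‖ - 1) ^ 2 / (2 * θ) := by positivity
      have e : θ / 2 * ‖k t‖ ^ 2 + 1 / (2 * θ) - ‖k t‖ = (θ * ‖k t‖ - 1) ^ 2 / (2 * θ) := by
        field_simp; ring
      linarith
    · have h0 : k t = 0 := by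
        have : t ∉ Function.support k := fun h ↦ ht (hs (subset_tsupport _ h))
        simpa [Function.mem_support] using this
      rw [h0, indicator_of_notMem ht]; simp
  have hind : Integrable ((Icc a b).indicator fun _ : ℝ ↦ (1 : ℝ)) :=
    (continuousOn_const.integrableOn_Icc (μ := volume)).integrable_indicator measurableSet_Icc
  have hint : ∫ t : ℝ, ‖k t‖ ≤ ∫ t : ℝ, (θ / 2 * ‖k t‖ ^ 2 +
      1 / (2 * θ) * (Icc a b).indicator (fun _ ↦ (1 : ℝ)) t) :=
    integral_mono hni ((hsqi.const_mul (θ / 2)).add (hind.const_mul (1 / (2 * θ)))) hpt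
  rw [integral_add (hsqi.const_mul _) (hind.const_mul _), integral_const_mul, integral_const_mul,
    integral_indicator_const _ measurableSet_Icc, Real.volume_real_Icc_of_le hab.le, smul_eq_mul, mul_one,
    ← hI] at hint
  have h2 : m ≤ θ / 2 * I + 1 / (2 * θ) * (b - a) := hm.trans hint
  have hba : (b - a) ≠ 0 := by linarith
  have e1 : 1 / (2 * θ) * (b - a) = m / 2 := by
    rw [hθ]; field_simp
  have e2 : θ / 2 * I = (b - a) * I / (2 * m) := by
    rw [hθ]; field_simp
  rw [e1, e2] at h2
  have h5 : m / 2 ≤ (b - a) * I / (2 * m) := by linarith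
  rw [le_div_iff₀ (by positivity)] at h5
  nlinarith

/-- Lower bound on the prolate guess at `s = 0` from Fact 6.4 and `ξ(½) ≠ 0`:
`‖M_λ(0)‖ ≥ ‖ξ(½)‖/8` for `λ ≥ Λ`. -/
theorem exists_norm_prolateGuessMellin_zero_ge (hX : prolateGuess_tendsto_riemannXi) :
    ∃ Λ : ℝ, ∀ lam : ℝ, Λ ≤ lam → ∀ f0 f4 : ℝ → ℝ,
      IsProlateFunction lam 0 f0 → IsProlateFunction lam 4 f4 →
        ‖riemannXi (1 / 2)‖ / 8 ≤ ‖prolateGuessMellin lam f0 f4 0‖ := by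
  have hxi : 0 < ‖riemannXi (1 / 2)‖ := norm_pos_iff.2 riemannXi_one_half_ne_zero
  obtain ⟨Λ, hΛ⟩ := hX 0 le_rfl (by norm_num) (‖riemannXi (1 / 2)‖ / 2) (by positivity)
  refine ⟨Λ, fun lam hlam f0 f4 h0 h4 ↦ ?_⟩
  have h := hΛ lam hlam f0 f4 h0 h4 0 (by simp)
  rw [add_zero] at h
  have h1 : ‖riemannXi (1 / 2)‖ ≤ ‖4 * prolateGuessMellin lam f0 f4 0 - riemannXi (1 / 2)‖ +
      ‖4 * prolateGuessMellin lam f0 f4 0‖ := by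
    have := norm_sub_le (4 * prolateGuessMellin lam f0 f4 0)
      (4 * prolateGuessMellin lam f0 f4 0 - riemannXi (1 / 2))
    rw [sub_sub_cancel] at this
    linarith [norm_sub_rev (4 * prolateGuessMellin lam f0 f4 0 - riemannXi (1 / 2))
      (4 * prolateGuessMellin lam f0 f4 0)]
  have h2 : ‖(4 : ℂ) * prolateGuessMellin lam f0 f4 0‖ = 4 * ‖prolateGuessMellin lam f0 f4 0‖ := by
    rw [norm_mul]; norm_num
  linarith

/-- `k̂(½) = M_λ(0)` for the mollified leak witness (`φ̂_n(½) = ∫ φ_n = 1`). -/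
theorem weilMellin_leakWitness_one_half (hE : existsUnique_isProlateFunction) {lam : ℝ} {f0 f4 : ℝ → ℝ}
    (h0 : IsProlateFunction lam 0 f0) (h4 : IsProlateFunction lam 4 f4) (n : ℕ) :
    weilMellin (leakWitness lam f0 f4 n) (1 / 2) = prolateGuessMellin lam f0 f4 0 := by
  rw [weilMellin_leakWitness hE h0 h4 n, sub_self, GroundStatesConvergeToXi.momentsOfStrip_weilMellin_half,
    integral_moll, mul_one]

/-- **PROVED: the norm floor, from Fact 6.4 (`prolateGuess_tendsto_riemannXi`, CCM25 Lemma 7.3) and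
`ξ(½) ≠ 0`.**  With `Λ' = max(Λ₆.₄, 0)²` and `c = (‖ξ(½)‖/8)²`. -/
theorem leakWitnessNormFloor_of_tendsto (hE : existsUnique_isProlateFunction)
    (hX : prolateGuess_tendsto_riemannXi) : ∃ Λ' c : ℝ, LeakWitnessNormFloor Λ' c := by
  obtain ⟨Λ, hΛ⟩ := exists_norm_prolateGuessMellin_zero_ge hX
  have hxi : 0 < ‖riemannXi (1 / 2)‖ := norm_pos_iff.2 riemannXi_one_half_ne_zero
  refine ⟨(max Λ 0) ^ 2, (‖riemannXi (1 / 2)‖ / 8) ^ 2, by positivity, fun N hN f0 f4 h0 h4 n ↦ ?_⟩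
  have hlam0 : 0 < Real.sqrt N := h0.lam_pos
  have hN0 : (0 : ℝ) < N := Real.sqrt_pos.1 hlam0
  have hNne : N ≠ 0 := by rintro rfl; simp at hN0
  have hN1 : (1 : ℝ) ≤ N := by exact_mod_cast Nat.one_le_iff_ne_zero.2 hNne
  have hΛN : Λ ≤ Real.sqrt N := by
    have h1 : max Λ 0 ≤ Real.sqrt N := by
      rw [show max Λ 0 = Real.sqrt ((max Λ 0) ^ 2) from (Real.sqrt_sq (le_max_right _ _)).symm]
      exact Real.sqrt_le_sqrt hN
    exact (le_max_left _ _).trans h1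
  have hM := hΛ (Real.sqrt N) hΛN f0 f4 h0 h4
  have hk : IsWeilTest (leakWitness (Real.sqrt N) f0 f4 n) := isWeilTest_leakWitness hE h0 h4 n
  have hsupp := tsupport_leakWitness_subset hlam0 f0 f4 n
  have hlog0 : 0 ≤ Real.log (Real.sqrt N) :=
    Real.log_nonneg ((Real.le_sqrt' one_pos).2 (by rw [one_pow]; exact hN1))
  have hn1 : (0 : ℝ) < 1 / ((n : ℝ) + 1) := by positivity
  have hab : -(Real.log (Real.sqrt N) + 1 / ((n : ℝ) + 1)) <
      Real.log (Real.sqrt N) + 1 / ((n : ℝ) + 1) := by linarith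
  have hCS := norm_integral_sq_le hk hab hsupp
  have hval : ‖∫ t : ℝ, leakWitness (Real.sqrt N) f0 f4 n t‖ =
      ‖prolateGuessMellin (Real.sqrt N) f0 f4 0‖ := by
    rw [← GroundStatesConvergeToXi.momentsOfStrip_weilMellin_half, weilMellin_leakWitness_one_half hE h0 h4 n]
  have hlen : Real.log (Real.sqrt N) + 1 / ((n : ℝ) + 1) - -(Real.log (Real.sqrt N) + 1 / ((n : ℝ) + 1)) ≤
      Real.log N + 2 := by
    rw [Real.log_sqrt hN0.le]
    have : 1 / ((n : ℝ) + 1) ≤ 1 := by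
      rw [div_le_one (by positivity)]; linarith [n.cast_nonneg (α := ℝ)]
    linarith
  have hI0 : 0 ≤ ∫ t : ℝ, ‖leakWitness (Real.sqrt N) f0 f4 n t‖ ^ 2 :=
    integral_nonneg fun _ ↦ by positivity
  calc (‖riemannXi (1 / 2)‖ / 8) ^ 2 ≤ ‖prolateGuessMellin (Real.sqrt N) f0 f4 0‖ ^ 2 :=
        pow_le_pow_left₀ (by positivity) hM 2
    _ = ‖∫ t : ℝ, leakWitness (Real.sqrt N) f0 f4 n t‖ ^ 2 := by rw [hval]
    _ ≤ (Real.log (Real.sqrt N) + 1 / ((n : ℝ) + 1) - -(Real.log (Real.sqrt N) + 1 / ((n : ℝ) + 1))) *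
          ∫ t : ℝ, ‖leakWitness (Real.sqrt N) f0 f4 n t‖ ^ 2 := hCS
    _ ≤ (Real.log N + 2) * ∫ t : ℝ, ‖leakWitness (Real.sqrt N) f0 f4 n t‖ ^ 2 :=
        mul_le_mul_of_nonneg_right hlen hI0

/-! ## §L The headline: (H-LEAK-L1) + two named literature facts ⇒ the upper law -/

/-- **HEADLINE (PROVED REDUCTION).**  Assume the Slepian–Pollak uniqueness of the prolate functions
(`existsUnique_isProlateFunction`, named fact) and Connes–Consani–Moscovici's Lemma 7.3
(`prolateGuess_tendsto_riemannXi`, named fact, proved in print, RH-free).  Then the prolate leak bound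
(H-LEAK-L1) with exponent `p` gives the upper half of Connes's law with EVERY exponent `> 2p + 1`:
`ProlateLeakL1 A p Λ → ∀ δ ∈ (0,1], ConnesLawUpperWith (2p + 1 + δ)`.  No RH anywhere. -/
theorem connesLawUpperWith_of_prolateLeak (hE : existsUnique_isProlateFunction)
    (hX : prolateGuess_tendsto_riemannXi) {A p Λ : ℝ} (hA : 0 ≤ A) (hp : 0 ≤ p)
    (hL : ProlateLeakL1 A p Λ) {δ : ℝ} (hδ : 0 < δ) (hδ1 : δ ≤ 1) :
    ConnesLawUpperWith (2 * p + 1 + δ) := by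
  obtain ⟨Λ', c, hF⟩ := leakWitnessNormFloor_of_tendsto hE hX
  exact connesLawUpperWith_of_leak hE hA hp hL mollifierMellinDecay hF hδ hδ1

/-- **HEADLINE, witness form** — exactly the `hp ∧ hU` input of `PfPersistenceM2Laws.m2_asymptotic_of_three_laws`
with `B_U = 2p + 1 + δ`: eventually in `a`, a normalised window test (the mollified prolate guess
`k₀ ⋆ φ_n / ‖k₀ ⋆ φ_n‖₂`) with Weil energy `≤ C μ^{2p+1+δ} e^{-4πμ}`.  No RH anywhere. -/
theorem connesLawUpperWitnessWith_of_prolateLeak (hE : existsUnique_isProlateFunction)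
    (hX : prolateGuess_tendsto_riemannXi) {A p Λ : ℝ} (hA : 0 ≤ A) (hp : 0 ≤ p)
    (hL : ProlateLeakL1 A p Λ) {δ : ℝ} (hδ : 0 < δ) (hδ1 : δ ≤ 1) :
    ConnesLawUpperWitnessWith (2 * p + 1 + δ) := by
  obtain ⟨Λ', c, hF⟩ := leakWitnessNormFloor_of_tendsto hE hX
  exact connesLawUpperWitnessWith_of_leak hE hA hp hL mollifierMellinDecay hF hδ hδ1

/-- **COROLLARY.**  In particular (H-LEAK-L1) gives the tree's `ConnesLawUpper` (CLAIM C6 of the solo memo,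
an open conjunct of several RH routes) — conditionally on the two named literature facts only. -/
theorem connesLawUpper_of_prolateLeak (hE : existsUnique_isProlateFunction)
    (hX : prolateGuess_tendsto_riemannXi) {A p Λ : ℝ} (hA : 0 ≤ A) (hp : 0 ≤ p)
    (hL : ProlateLeakL1 A p Λ) : ConnesLawUpper :=
  connesLawUpper_of_with (connesLawUpperWith_of_prolateLeak hE hX hA hp hL one_pos le_rfl)

end Floor

/-! ## §M The `sup` form of the input — literally the shape of the bundle's THEOREM E′ — implies (H-LEAK-L1) -/

section SupForm

/-- **HYPOTHESIS (H-LEAK-SUP) — the `sup` form of the prolate leak bound**, literally the shape of the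
connes-x13 bundle's THEOREM E′ (+ Cor. 11): for integers `N = λ² ≥ Λ`, every prolate pair and every
`0 < u < λ⁻¹`, `|𝓔(h_λ)(u)| ≤ A N^p e^{−2πN} √u`, i.e. `sup_{0<u<1/λ} |S_λ(u)| ≤ A λ^{2p} e^{−2πλ²}` for the
FINITE Riemann sum `S_λ(u) = Σ_{n≥1} h_λ(nu) = 𝓔(h_λ)(u)/√u` (bounded, no blow-up at `λu → 1`).  The bundle
proves it ON PAPER (RH-free, modulo three cited classical prolate inputs) with `p = 9/2`
(`Σ*_λ ≍ 10⁴ λ⁹ e^{−2πλ²}`); unformalised, hence `@[conjecture]` = open obligation node of the tree.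
It implies the `L¹` form (`prolateLeakL1_of_sup`). -/
@[conjecture] def ProlateLeakSup (A p Λ : ℝ) : Prop :=
  ∀ N : ℕ, Λ ≤ (N : ℝ) → ∀ f0 f4 : ℝ → ℝ,
    IsProlateFunction (Real.sqrt N) 0 f0 → IsProlateFunction (Real.sqrt N) 4 f4 →
    ∀ u : ℝ, 0 < u → u < 1 / Real.sqrt N →
      |connesE (prolateGuessH (Real.sqrt N) f0 f4) u|
        ≤ A * (N : ℝ) ^ p * Real.exp (-(2 * Real.pi * N)) * Real.sqrt u

/-- **`sup` form ⇒ `L¹` form** (with `Λ ↦ max Λ 1`):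
`β ∫_{(0,λ⁻¹]} |𝓔(h_λ)| u^{β−3/2} du ≤ A N^p e^{−2πN} · β ∫₀^{λ⁻¹} u^{β−1} du = A N^p e^{−2πN} λ^{−β} ≤ A N^p e^{−2πN}`. -/
theorem prolateLeakL1_of_sup {A p Λ : ℝ} (h : ProlateLeakSup A p Λ) : ProlateLeakL1 A p (max Λ 1) := by
  intro N hN f0 f4 h0 h4 β hβ hβ1
  have hN1 : (1 : ℝ) ≤ N := (le_max_right _ _).trans hN
  have hΛN : Λ ≤ (N : ℝ) := (le_max_left _ _).trans hN
  have hsN : 1 ≤ Real.sqrt N := (Real.le_sqrt' one_pos).2 (by rw [one_pow]; exact hN1)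
  obtain ⟨r, hr⟩ : ∃ r : ℝ, r = 1 / Real.sqrt N := ⟨_, rfl⟩
  obtain ⟨K, hK⟩ : ∃ K : ℝ, K = A * (N : ℝ) ^ p * Real.exp (-(2 * Real.pi * N)) := ⟨_, rfl⟩
  obtain ⟨E, hE⟩ : ∃ E : ℝ → ℝ, E = connesE (prolateGuessH (Real.sqrt N) f0 f4) := ⟨_, rfl⟩
  have hr0 : 0 < r := by rw [hr]; positivity
  have hr1 : r ≤ 1 := by rw [hr]; exact (div_le_one (by positivity)).2 hsN
  have hsup : ∀ u : ℝ, 0 < u → u < r → |E u| ≤ K * Real.sqrt u := by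
    intro u hu hur
    rw [hE, hK]
    exact h N hΛN f0 f4 h0 h4 u hu (by rw [← hr]; exact hur)
  have hK0 : 0 ≤ K := by
    have hu : 0 < r / 2 := by positivity
    have hs : 0 < Real.sqrt (r / 2) := Real.sqrt_pos.2 hu
    have hb := hsup (r / 2) hu (by linarith)
    by_contra hneg
    push Not at hneg
    have := mul_neg_of_neg_of_pos hneg hs
    linarith [abs_nonneg (E (r / 2))]
  rw [← hr, ← hE, ← hK, ← setIntegral_congr_set Ioo_ae_eq_Ioc]
  have hmaj : IntegrableOn (fun u : ℝ ↦ K * u ^ (β - 1)) (Ioo 0 r) := by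
    have hii := intervalIntegral.intervalIntegrable_rpow' (a := 0) (b := r) (by linarith : -1 < β - 1)
    rw [intervalIntegrable_iff_integrableOn_Ioo_of_le hr0.le] at hii
    exact hii.const_mul K
  have hle : ∫ u in Ioo 0 r, |E u| * u ^ (β - 3 / 2) ≤ ∫ u in Ioo 0 r, K * u ^ (β - 1) := by
    refine integral_mono_of_nonneg ?_ hmaj ?_
    · exact (ae_restrict_mem measurableSet_Ioo).mono fun u hu ↦
        mul_nonneg (abs_nonneg _) (Real.rpow_nonneg hu.1.le _)
    · refine (ae_restrict_mem measurableSet_Ioo).mono fun u hu ↦ ?_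
      have hu0 : 0 < u := hu.1
      have hsq : Real.sqrt u * u ^ (β - 3 / 2) = u ^ (β - 1) := by
        rw [Real.sqrt_eq_rpow, ← Real.rpow_add hu0]
        ring_nf
      calc |E u| * u ^ (β - 3 / 2) ≤ K * Real.sqrt u * u ^ (β - 3 / 2) :=
            mul_le_mul_of_nonneg_right (hsup u hu0 hu.2) (Real.rpow_nonneg hu0.le _)
        _ = K * u ^ (β - 1) := by rw [mul_assoc, hsq]
  have hval : ∫ u in Ioo 0 r, K * u ^ (β - 1) = K * (r ^ β / β) := by
    rw [integral_const_mul, setIntegral_congr_set Ioo_ae_eq_Ioc, ← intervalIntegral.integral_of_le hr0.le,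
      integral_rpow (Or.inl (by linarith)), sub_add_cancel, Real.zero_rpow hβ.ne', sub_zero]
  calc β * ∫ u in Ioo 0 r, |E u| * u ^ (β - 3 / 2) ≤ β * (K * (r ^ β / β)) :=
        mul_le_mul_of_nonneg_left (hle.trans_eq hval) hβ.le
    _ = K * r ^ β := by field_simp
    _ ≤ K * 1 := mul_le_mul_of_nonneg_left (Real.rpow_le_one hr0.le hr1 hβ.le) hK0
    _ = K := mul_one K

/-- **HEADLINE from the `sup` form** (the bundle's THEOREM E′ shape), witness form. -/
theorem connesLawUpperWitnessWith_of_prolateLeakSup (hE : existsUnique_isProlateFunction)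
    (hX : prolateGuess_tendsto_riemannXi) {A p Λ : ℝ} (hA : 0 ≤ A) (hp : 0 ≤ p)
    (hS : ProlateLeakSup A p Λ) {δ : ℝ} (hδ : 0 < δ) (hδ1 : δ ≤ 1) :
    ConnesLawUpperWitnessWith (2 * p + 1 + δ) :=
  connesLawUpperWitnessWith_of_prolateLeak hE hX hA hp (prolateLeakL1_of_sup hS) hδ hδ1

/-- **HEADLINE from the `sup` form**, energy form: `… → ConnesLawUpperWith (2p + 1 + δ)`. -/
theorem connesLawUpperWith_of_prolateLeakSup (hE : existsUnique_isProlateFunction)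
    (hX : prolateGuess_tendsto_riemannXi) {A p Λ : ℝ} (hA : 0 ≤ A) (hp : 0 ≤ p)
    (hS : ProlateLeakSup A p Λ) {δ : ℝ} (hδ : 0 < δ) (hδ1 : δ ≤ 1) :
    ConnesLawUpperWith (2 * p + 1 + δ) :=
  connesLawUpperWith_of_prolateLeak hE hX hA hp (prolateLeakL1_of_sup hS) hδ hδ1

end SupForm

end Summit.RiemannHypothesis.RiemannHypothesis.Theorems.PfPersistenceM2Leak
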